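import Literature.AnabelianGeometry.EtaleTheta.Discharge.Sec2TowerLemmas

/-!
# [EtTh] §2 discharge: descent of automorphisms of `Π^tp_Y[μ_{M'}]` along `μ_{M'} ↠ μ_M`
# (towards Cor 2.18 (iv), "the natural homomorphism `Aut^μ(M_{N'}) → Aut^μ(M_N)`")

Mochizuki, *The Étale Theta Function and its Frobenioid-theoretic Manifestations* [EtTh],
Publ. RIMS 45 (2009), §2, Def 2.13 (ii) p.48 ("`M_{N'}`, the mod `N'` environment induced by `M`"),
Cor 2.18 (iv) pp.61–63 (locators `p.N` = PDF pages of the PRIMS text; bib key `MochizukiEtTh2009`).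
PROOF-ONLY companion (no `def`, no new named fact; seat abc-iut-L2-d1, input-discharge for
`ThetaEnvTower.Cor218_iv_reduction`, a hypothesis of the Cor 2.19 (ii) discharge) of
`ThetaSystems.lean` (seat abc-iut-L2-t2). Pure group theory / topology:

* `ThetaEnvTower.exists_pow_of_map_ker` — an automorphism of `Π^tp_Y[μ_M]` preserving the cyclotome
  `μ_M = Ker(↠ Π^tp_Y)` acts on it by a power map (`μ_M` cyclic), hence preserves `Ker(μ_{M'} ↠ μ_M)`;
* `ThetaEnvTower.exists_reduces` — every automorphism of the topological group `Π^tp_Y[μ_{M'}]`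
  preserving the cyclotome DESCENDS along the reduction `Π^tp_Y[μ_{M'}] ↠ Π^tp_Y[μ_M]` to an
  automorphism of the topological group `Π^tp_Y[μ_M]` (existence; uniqueness is
  `ThetaEnvTower.reduces_unique`);
* the reductions of the generators of `D_Y`: `conjX`, Kummer shifts, inner automorphisms.

HONEST FRAMING: no side is taken on [IUTchIII] Cor 3.12; typed ≠ discharged elsewhere.
-/

namespace Literature.AnabelianGeometry.EtaleTheta

universe u

namespace ThetaEnvTower

variable {E : Set ℕ+} (T : ThetaEnvTower.{u} E)

/-- The reduction `Π^tp_Y[μ_{M'}] → Π^tp_Y[μ_M]` is continuous. [cite: MochizukiEtTh2009, Def 2.13(ii) p.48] -/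
theorem continuous_redEnv (M M' : E) (h : (M : ℕ+) ∣ M') : Continuous (T.redEnv M M' h) :=
  (T.level M).continuous_env_mk
    (continuous_of_discreteTopology.comp (T.level M').continuous_left) (T.level M').continuous_right

/-- An automorphism of `Π^tp_Y[μ_M]` preserving the cyclotome `μ_M` acts on it by a power map
(`μ_M` is cyclic). [cite: MochizukiEtTh2009, Cor 2.18(iv) p.62] -/
theorem exists_pow_of_map_ker (M : E) (φ : (T.level M).env ≃* (T.level M).env)
    (hker : ((CycEnvelope.proj (T.level M).augY (T.level M).chi).ker).map φ.toMonoidHom =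
      (CycEnvelope.proj (T.level M).augY (T.level M).chi).ker) :
    ∃ k : ℤ, ∀ m : T.mu M, φ (CycEnvelope.inMu (T.level M).augY (T.level M).chi m) =
      CycEnvelope.inMu (T.level M).augY (T.level M).chi (m ^ k) := by
  have hright : ∀ m : T.mu M,
      (φ (CycEnvelope.inMu (T.level M).augY (T.level M).chi m)).right = 1 := by
    intro m
    have : φ (CycEnvelope.inMu (T.level M).augY (T.level M).chi m) ∈
        (CycEnvelope.proj (T.level M).augY (T.level M).chi).ker := by
      have h1 : CycEnvelope.inMu (T.level M).augY (T.level M).chi m ∈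
          (CycEnvelope.proj (T.level M).augY (T.level M).chi).ker := by
        rw [MonoidHom.mem_ker]; rfl
      rw [← hker]
      exact ⟨_, h1, rfl⟩
    rwa [MonoidHom.mem_ker] at this
  have hform : ∀ m : T.mu M, φ (CycEnvelope.inMu (T.level M).augY (T.level M).chi m) =
      CycEnvelope.inMu (T.level M).augY (T.level M).chi
        (φ (CycEnvelope.inMu (T.level M).augY (T.level M).chi m)).left := by
    intro m
    ext
    · rfl
    · rw [hright m]; rfl
  let a : T.mu M →* T.mu M :=
    { toFun := fun m => (φ (CycEnvelope.inMu (T.level M).augY (T.level M).chi m)).left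
      map_one' := by rw [map_one, map_one]; rfl
      map_mul' := fun m n => by
        rw [map_mul, map_mul, SemidirectProduct.mul_left, hright m, map_one, MulAut.one_apply] }
  haveI := T.mu_cyclic M
  obtain ⟨k, hk⟩ := MonoidHom.map_cyclic a
  exact ⟨k, fun m => by rw [hform m]; exact congrArg _ (hk m)⟩

/-- **Descent of automorphisms along `Π^tp_Y[μ_{M'}] ↠ Π^tp_Y[μ_M]`**: an automorphism of the
topological group `Π^tp_Y[μ_{M'}]` preserving the cyclotome `μ_{M'}` reduces to an automorphism of
the topological group `Π^tp_Y[μ_M]` (Def 2.13 (ii) "`M_{N'}` … induced by `M`"; Cor 2.18 (iv) "a natural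
homomorphism `Aut^μ(M) → Aut^μ(M_M)`"). [cite: MochizukiEtTh2009, Cor 2.18(iv) p.61] -/
theorem exists_reduces {M M' : E} (h : (M : ℕ+) ∣ M')
    (φ : (T.level M').env ≃ₜ* (T.level M').env)
    (hker : ((CycEnvelope.proj (T.level M').augY (T.level M').chi).ker).map
      φ.toMulEquiv.toMonoidHom = (CycEnvelope.proj (T.level M').augY (T.level M').chi).ker) :
    ∃ ψ : (T.level M).env ≃ₜ* (T.level M).env, T.Reduces h φ.toMulEquiv ψ.toMulEquiv := by
  -- power maps on `μ_{M'}` for `φ`, `φ⁻¹`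
  obtain ⟨k, hk⟩ := T.exists_pow_of_map_ker M' φ.toMulEquiv hker
  obtain ⟨k', hk'⟩ := T.exists_pow_of_map_ker M' φ.symm.toMulEquiv
    ((T.level M').map_ker_symm_of_map_ker φ hker)
  -- a set-theoretic section of the reduction
  have hσ := T.red_surjective M M' h
  let σ : T.mu M → T.mu M' := Function.surjInv hσ
  have hσ' : ∀ m, T.red M M' h (σ m) = m := Function.surjInv_eq hσ
  let lift : (T.level M).env → (T.level M').env := fun y => ⟨σ y.left, y.right⟩
  have hlift : ∀ y, T.redEnv M M' h (lift y) = y := fun y => by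
    ext
    · exact hσ' y.left
    · rfl
  have hdec : ∀ x : (T.level M').env, ∃ n : T.mu M', T.red M M' h n = 1 ∧
      x = CycEnvelope.inMu (T.level M').augY (T.level M').chi n * lift (T.redEnv M M' h x) := by
    intro x
    refine ⟨x.left * (σ (T.red M M' h x.left))⁻¹, by rw [map_mul, map_inv, hσ', mul_inv_cancel], ?_⟩
    ext
    · simp [lift, left_redEnv]
    · simp [lift, right_redEnv]
  -- reductions kill `Ker(μ_{M'} ↠ μ_M)` and its powers
  have hkill : ∀ (n : T.mu M') (j : ℤ), T.red M M' h n = 1 →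
      T.redEnv M M' h (CycEnvelope.inMu (T.level M').augY (T.level M').chi (n ^ j)) = 1 := by
    intro n j hn
    ext
    · rw [left_redEnv, SemidirectProduct.left_inl, map_zpow, hn, one_zpow]; rfl
    · rfl
  -- a well-defined reduction for any automorphism acting on `μ_{M'}` by a power map
  have hWD : ∀ (ψ : (T.level M').env ≃ₜ* (T.level M').env) (j : ℤ),
      (∀ m : T.mu M', ψ (CycEnvelope.inMu (T.level M').augY (T.level M').chi m) =
        CycEnvelope.inMu (T.level M').augY (T.level M').chi (m ^ j)) →
      ∀ x, T.redEnv M M' h (ψ x) = T.redEnv M M' h (ψ (lift (T.redEnv M M' h x))) := by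
    intro ψ j hψ x
    obtain ⟨n, hn, hx⟩ := hdec x
    conv_lhs => rw [hx]
    rw [map_mul, hψ, map_mul, hkill n j hn, one_mul]
  let α₀ : (T.level M).env → (T.level M).env := fun y => T.redEnv M M' h (φ (lift y))
  let β₀ : (T.level M).env → (T.level M).env := fun y => T.redEnv M M' h (φ.symm (lift y))
  have hαred : ∀ x, T.redEnv M M' h (φ x) = α₀ (T.redEnv M M' h x) := fun x => hWD φ k hk x
  have hβred : ∀ x, T.redEnv M M' h (φ.symm x) = β₀ (T.redEnv M M' h x) :=
    fun x => hWD φ.symm k' hk' x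
  have hmul : ∀ y₁ y₂, α₀ (y₁ * y₂) = α₀ y₁ * α₀ y₂ := fun y₁ y₂ => by
    have h12 := hαred (lift y₁ * lift y₂)
    rw [map_mul (T.redEnv M M' h), hlift, hlift] at h12
    rw [← h12, map_mul, map_mul, hαred, hαred, hlift, hlift]
  have hleft : ∀ y, β₀ (α₀ y) = y := fun y => by
    change T.redEnv M M' h (φ.symm (lift (T.redEnv M M' h (φ (lift y))))) = y
    rw [show T.redEnv M M' h (φ.symm (lift (T.redEnv M M' h (φ (lift y))))) =
      T.redEnv M M' h (φ.symm (φ (lift y))) from (hβred _).symm,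
      ContinuousMulEquiv.symm_apply_apply, hlift]
  have hright : ∀ y, α₀ (β₀ y) = y := fun y => by
    change T.redEnv M M' h (φ (lift (T.redEnv M M' h (φ.symm (lift y))))) = y
    rw [show T.redEnv M M' h (φ (lift (T.redEnv M M' h (φ.symm (lift y))))) =
      T.redEnv M M' h (φ (φ.symm (lift y))) from (hαred _).symm,
      ContinuousMulEquiv.apply_symm_apply, hlift]
  let αE : (T.level M).env ≃* (T.level M).env :=
    { toFun := α₀, invFun := β₀, left_inv := hleft, right_inv := hright, map_mul' := hmul }
  have hcl : Continuous lift := (T.level M').continuous_env_mk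
    (show Continuous (fun y : (T.level M).env => σ y.left) from
      (continuous_of_discreteTopology : Continuous σ).comp (T.level M).continuous_left)
    (T.level M).continuous_right
  have hcα : Continuous α₀ := (T.continuous_redEnv M M' h).comp (φ.continuous.comp hcl)
  have hcβ : Continuous β₀ := (T.continuous_redEnv M M' h).comp (φ.symm.continuous.comp hcl)
  exact ⟨ContinuousMulEquiv.mk αE hcα hcβ, hαred⟩

/-- `conjX g` at level `M'` reduces to `conjX g` at level `M`. [cite: MochizukiEtTh2009, Cor 2.18(iv) p.61] -/
theorem reduces_conjX {M M' : E} (h : (M : ℕ+) ∣ M') (g : T.PiX) :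
    T.Reduces h ((T.level M').conjX g) ((T.level M).conjX g) := fun x => by
  ext
  · simp only [left_redEnv, ThetaEnvData.conjX, MulEquiv.coe_mk, Equiv.coe_fn_mk]
    exact T.red_chi M M' h _ _
  · rfl

/-- The reduction of a cocycle is a cocycle. [cite: MochizukiEtTh2009, Cor 2.18(iv) p.61] -/
theorem isEnvCocycle_red_comp {M M' : E} (h : (M : ℕ+) ∣ M') {δ' : T.PiY → T.mu M'}
    (hδ' : CycEnvelope.IsEnvCocycle (T.level M').augY (T.level M').chi δ') :
    CycEnvelope.IsEnvCocycle (T.level M).augY (T.level M).chi (T.red M M' h ∘ δ') := fun g g' => by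
  simp only [Function.comp_apply, hδ' g g', map_mul]
  congr 1
  exact T.red_chi M M' h _ _

/-- A Kummer shift at level `M'` reduces to the shift by the reduced cocycle.
[cite: MochizukiEtTh2009, Cor 2.18(iv) p.61] -/
theorem reduces_shift {M M' : E} (h : (M : ℕ+) ∣ M') {δ' : T.PiY → T.mu M'}
    (hδ' : CycEnvelope.IsEnvCocycle (T.level M').augY (T.level M').chi δ') :
    T.Reduces h (CycEnvelope.shift hδ') (CycEnvelope.shift (T.isEnvCocycle_red_comp h hδ')) :=
  fun x => by
  ext
  · simp only [CycEnvelope.shift_apply, left_redEnv, right_redEnv, map_mul, Function.comp_apply]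
  · rfl

/-- Inner automorphisms reduce to inner automorphisms. [cite: MochizukiEtTh2009, Cor 2.18(iv) p.61] -/
theorem reduces_conj {M M' : E} (h : (M : ℕ+) ∣ M') (y : (T.level M').env) :
    T.Reduces h (MulAut.conj y) (MulAut.conj (T.redEnv M M' h y)) := fun x => by
  rw [MulAut.conj_apply, MulAut.conj_apply, map_mul, map_mul, map_inv]

end ThetaEnvTower

end Literature.AnabelianGeometry.EtaleTheta
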